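import Mathlib
import Summits.KontsevichZagierPeriods.Zeta5Search.LaiBoxReflection
import Literature.NumberTheory.Transcendental.ReciprocalBricks
import Literature.NumberTheory.Transcendental.NesterenkoBricksPadic
import HarnessLib


/-!
# ζ(5) search — Lai's box function as a product of Nesterenko bricks; `D`-integrality and `p`-adic
# orders of its regularised products (fam-indep, κ₃ ladder: the L1 / Φ̃ input, step 1)

HONEST FRAMING: systematic search; no irrationality claim unless certified.

OUR work (Summit side; cell `pub-zeta5`, family `indep`, planner seat gen 4, STAGED for the lane).
For Lai's very-well-poised box function ([Lai2024BallRivoal, §13, proof of Claim 1.4];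
tree: `laiCore J r M n δ t = laiNum r M n t / laiDen J M n δ t`, file `LaiBoxReflection.lean`, the
summand WITHOUT the constant `C_n = ∏_j ((M−2δ_j)n)! / n!^{2r}`) we prove, following the tree's
Zudilin-2004 template (`Literature/NumberTheory/Transcendental/ZudilinBricks(Arith).lean`) verbatim:

* `laiC_mul_laiCore` — **the brick factorisation** `C_n · laiCore(t) = laiR(t)` for EVERY `t`, where
  `laiR = (2t + Mn) · ∏_{q<r} polyBrick(−rn+qn, n) · ∏_{q<r} polyBrick(Mn+1+qn, n) · ∏_j recipBrick(δ_jn, (M−2δ_j)n+1)`: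
  the `2r` polynomial bricks of LENGTH `n` eat `n!^{2r}` and the `J` reciprocal bricks eat `∏_j ((M−2δ_j)n)!`,
  so `C_n` is absorbed exactly ([BallRivoal2001]/[Rivoal2000] decomposition of `(t−rn)_{rn}` into `r` blocks of
  `n` consecutive factors; [Zudilin2004, (7.3)]);
* `laiG`, `laiG_eq` — the product `laiR(t)·(t+k)^J` with its removable singularity at `t = −k` removed
  (each reciprocal brick absorbs one factor `t+k`, `recipBrickReg`), equal to `laiR(t)(t+k)^J` for `t ≠ −k`;
* `laiG_isDInt` — **`D_{(M−2δ_min)n}^j · (1/j!) laiG^{(j)}(−k) ∈ ℤ`** for every `j` and every pole index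
  `δ_min n ≤ k ≤ (M−δ_min)n` ([Zudilin2004, Lemmas 15–16] = tree `polyBrick_isDInt`, `recipBrickReg_isDInt`, and the
  product rule `IsDInt.prod`; `a₀ = δ_min n`, `b₀ = (M−δ_min)n+1`, `m₀ = b₀−a₀−1 = (M−2δ_min)n`) — the generic
  (`Φ̃`-free) part of Lai's lemma "L1" ([Lai2024BallRivoal, Lemma 4.1]);
* `laiG_isDOrd` — **`ord_p laiG^{(j)}(−k) ≥ −j + laiBrickExp`** for primes `p` with `(M−2δ_min)n < p²`
  ([Zudilin2004, Lemmas 17–18] = tree `polyBrick_isDOrd`, `recipBrickReg_isDOrd`, `IsDOrd.prod`), and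
  `laiBrickExp_eq_laiPhiDiv` — the brick exponents telescope to LAI'S TWO-VARIABLE SAVING FUNCTION
  `φ̃(n/p, k/p)` in integer-division form (`laiPhiDiv`): `⌊(k+rn)/p⌋ + ⌊((r+M)n−k)/p⌋ − ⌊k/p⌋ − ⌊(Mn−k)/p⌋ − 2r⌊n/p⌋
  + Σ_j (⌊(M−2δ_j)n/p⌋ − ⌊(k−δ_jn)/p⌋ − ⌊((M−δ_j)n−k)/p⌋)` ([Lai2024BallRivoal, §13, the function `φ̃(x,y)`]).

SEQUEL FILES (same seat; the gate caps a file at 400 lines, so the port is cut at section boundaries):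
`LaiBrickCoefficients.lean` (the partial-fraction coefficients ARE these divided derivatives: `divDeriv_laiG_eq`,
`lai_pf_isInt`, `laiCore_hasSum_pf`; pole orders: `lai_pf_eq_zero`), `LaiDenominators.lean` (summed denominators with Lai's
`M_j = max{M−2δ₁, M−δ_j}`, skeleton-shaped `laiCoef_hasSum/isInt/dvd3` for `Φ = 1`), `LaiSaving.lean` (the `Φ`-upgrade prime by
prime for any admissible exponent table). Everything here is PROVED (0 sorries); nothing is a named fact; no rate statement.

References: [Lai2024BallRivoal] L. Lai, arXiv:2407.14236, §4 (Lemma 4.1), §13; [Zudilin2004] W. Zudilin, J. Théor.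
Nombres Bordeaux 16 (2004), §7 (7.3), Lemmas 15–18; [BallRivoal2001] K. Ball, T. Rivoal, Invent. Math. 146 (2001);
[Rivoal2000] T. Rivoal, C. R. Acad. Sci. 331 (2000).
-/

noncomputable section

open Finset Filter Literature.NumberTheory.Transcendental Literature.Analysis.Calculus
open scoped Nat

namespace Summit.KontsevichZagierPeriods.Zeta5Search

/-! ### The bricks of Lai's box function -/

/-- Lai's constant `C_n = ∏_j ((M−2δ_j)n)! / n!^{2r}` (a rational; in fact an integer). [cite: Lai2024BallRivoal, §13] -/
def laiC (J r M n : ℕ) (δ : Fin J → ℕ) : ℚ :=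
  (∏ j, ((((M - 2 * δ j) * n)! : ℕ) : ℚ)) / ((n ! : ℚ) ^ (2 * r))

/-- `C_n · R̃`-summand as a product of bricks: `(2t+Mn) ∏_{q<r} polyBrick(−rn+qn,n) ∏_{q<r} polyBrick(Mn+1+qn,n)
∏_j recipBrick(δ_jn, (M−2δ_j)n+1)`. [this file] -/
def laiR (J r M n : ℕ) (δ : Fin J → ℕ) (t : ℚ) : ℚ :=
  (2 * t + (M : ℚ) * n) * (∏ q ∈ range r, polyBrick (-((r * n : ℕ) : ℤ) + ((q * n : ℕ) : ℤ)) n t) *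
    (∏ q ∈ range r, polyBrick (((M * n + 1 + q * n : ℕ) : ℤ)) n t) *
    ∏ j, recipBrick (((δ j * n : ℕ) : ℤ)) ((M - 2 * δ j) * n + 1) t

/-- The regularised product `laiR(t)·(t+k)^J` (each reciprocal brick absorbs one factor `t + k`). [this file] -/
def laiG (J r M n : ℕ) (δ : Fin J → ℕ) (k : ℕ) (t : ℚ) : ℚ :=
  (2 * t + (M : ℚ) * n) * (∏ q ∈ range r, polyBrick (-((r * n : ℕ) : ℤ) + ((q * n : ℕ) : ℤ)) n t) *
    (∏ q ∈ range r, polyBrick (((M * n + 1 + q * n : ℕ) : ℤ)) n t) *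
    ∏ j, recipBrickReg (((δ j * n : ℕ) : ℤ)) ((M - 2 * δ j) * n + 1) (k : ℤ) t

/-! ### Reindexing -/

/-- `∏_{m < r n} g m = ∏_{q<r} ∏_{l<n} g (q n + l)`. [folklore] -/
theorem prod_range_mul_eq (g : ℕ → ℚ) (r n : ℕ) :
    ∏ m ∈ range (r * n), g m = ∏ q ∈ range r, ∏ l ∈ range n, g (q * n + l) := by
  induction r with
  | zero => simp
  | succ r ih => rw [Nat.succ_mul, prod_range_add, ih, prod_range_succ]

/-- The falling numerator block: `∏_{i<rn} (t − (i+1)) = n!^r ∏_{q<r} polyBrick(−rn+qn, n)(t)`. [this file] -/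
theorem prod_sub_eq_polyBricks (r n : ℕ) (t : ℚ) :
    ∏ i ∈ range (r * n), (t - ((i : ℚ) + 1)) =
      (n ! : ℚ) ^ r * ∏ q ∈ range r, polyBrick (-((r * n : ℕ) : ℤ) + ((q * n : ℕ) : ℤ)) n t := by
  have hrefl : ∏ i ∈ range (r * n), (t - ((i : ℚ) + 1)) = ∏ m ∈ range (r * n), (t - (r * n : ℕ) + m) := by
    rw [← prod_range_reflect (fun m : ℕ => t - (r * n : ℕ) + m) (r * n)]
    refine prod_congr rfl fun i hi => ?_
    have hi' := mem_range.1 hi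
    rw [Nat.cast_sub (by omega), Nat.cast_sub (by omega)]
    push_cast; ring
  rw [hrefl, prod_range_mul_eq (fun m : ℕ => t - (r * n : ℕ) + m) r n]
  have hb : ∀ q ∈ range r, ∏ l ∈ range n, (t - (r * n : ℕ) + ((q * n + l : ℕ) : ℚ)) =
      (n ! : ℚ) * polyBrick (-((r * n : ℕ) : ℤ) + ((q * n : ℕ) : ℤ)) n t := by
    intro q _
    rw [polyBrick, mul_div_cancel₀ _ (by positivity)]
    refine prod_congr rfl fun l _ => ?_
    push_cast; ring
  rw [prod_congr rfl hb, prod_mul_distrib, prod_const, card_range]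

/-- The rising numerator block: `∏_{i<rn} (t + Mn + (i+1)) = n!^r ∏_{q<r} polyBrick(Mn+1+qn, n)(t)`. [this file] -/
theorem prod_add_eq_polyBricks (r M n : ℕ) (t : ℚ) :
    ∏ i ∈ range (r * n), (t + (M : ℚ) * n + ((i : ℚ) + 1)) =
      (n ! : ℚ) ^ r * ∏ q ∈ range r, polyBrick (((M * n + 1 + q * n : ℕ) : ℤ)) n t := by
  rw [prod_range_mul_eq (fun i : ℕ => t + (M : ℚ) * n + ((i : ℚ) + 1)) r n]
  have hb : ∀ q ∈ range r, ∏ l ∈ range n, (t + (M : ℚ) * n + (((q * n + l : ℕ) : ℚ) + 1)) =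
      (n ! : ℚ) * polyBrick (((M * n + 1 + q * n : ℕ) : ℤ)) n t := by
    intro q _
    rw [polyBrick, mul_div_cancel₀ _ (by positivity)]
    refine prod_congr rfl fun l _ => ?_
    push_cast; ring
  rw [prod_congr rfl hb, prod_mul_distrib, prod_const, card_range]

/-- A block of the denominator as a reciprocal brick: `recipBrick(δn, (M−2δ)n+1)(t) = ((M−2δ)n)! · (laiBlock M δ n t)⁻¹`.
[this file] -/
theorem recipBrick_eq_laiBlock_inv (M d n : ℕ) (t : ℚ) :
    recipBrick (((d * n : ℕ) : ℤ)) ((M - 2 * d) * n + 1) t =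
      ((((M - 2 * d) * n)! : ℕ) : ℚ) * (laiBlock M d n t)⁻¹ := by
  rw [recipBrick, laiBlock, ← prod_inv_distrib, Nat.add_sub_cancel]
  congr 1
  refine prod_congr rfl fun l _ => ?_
  push_cast; ring

/-! ### The brick factorisation -/

/-- **`C_n · laiCore = laiR`** for every `t` (at the poles both sides are `0`). [this file] -/
theorem laiC_mul_laiCore (J r M n : ℕ) (δ : Fin J → ℕ) (t : ℚ) :
    laiC J r M n δ * laiCore J r M n δ t = laiR J r M n δ t := by
  have hn : (n ! : ℚ) ≠ 0 := by positivity
  rw [laiCore, laiNum, laiDen, laiC, laiR, prod_sub_eq_polyBricks, prod_add_eq_polyBricks, div_eq_mul_inv,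
    div_eq_mul_inv, ← prod_inv_distrib]
  simp_rw [recipBrick_eq_laiBlock_inv]
  rw [prod_mul_distrib]
  have hpow : ((n ! : ℚ) ^ (2 * r))⁻¹ * ((n ! : ℚ) ^ r * (n ! : ℚ) ^ r) = 1 := by
    rw [← pow_add, ← two_mul, inv_mul_cancel₀ (pow_ne_zero _ hn)]
  calc (∏ j, ((((M - 2 * δ j) * n)! : ℕ) : ℚ)) * ((n ! : ℚ) ^ (2 * r))⁻¹ *
        ((2 * t + (M : ℚ) * n) * ((n ! : ℚ) ^ r * ∏ q ∈ range r, polyBrick (-((r * n : ℕ) : ℤ) + ((q * n : ℕ) : ℤ)) n t) *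
          ((n ! : ℚ) ^ r * ∏ q ∈ range r, polyBrick (((M * n + 1 + q * n : ℕ) : ℤ)) n t) *
          ∏ j, (laiBlock M (δ j) n t)⁻¹)
      = (((n ! : ℚ) ^ (2 * r))⁻¹ * ((n ! : ℚ) ^ r * (n ! : ℚ) ^ r)) *
        ((2 * t + (M : ℚ) * n) * (∏ q ∈ range r, polyBrick (-((r * n : ℕ) : ℤ) + ((q * n : ℕ) : ℤ)) n t) *
          (∏ q ∈ range r, polyBrick (((M * n + 1 + q * n : ℕ) : ℤ)) n t) *
          ((∏ j, ((((M - 2 * δ j) * n)! : ℕ) : ℚ)) * ∏ j, (laiBlock M (δ j) n t)⁻¹)) := by ring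
    _ = _ := by rw [hpow, one_mul]

/-- **`laiG = laiR · (t+k)^J` away from `t = −k`.** [this file] -/
theorem laiG_eq (J r M n : ℕ) (δ : Fin J → ℕ) (k : ℕ) {t : ℚ} (ht : t + k ≠ 0) :
    laiG J r M n δ k t = laiR J r M n δ t * (t + k) ^ J := by
  rw [laiG, laiR]
  have h : ∀ j ∈ (univ : Finset (Fin J)), recipBrickReg (((δ j * n : ℕ) : ℤ)) ((M - 2 * δ j) * n + 1) (k : ℤ) t =
      recipBrick (((δ j * n : ℕ) : ℤ)) ((M - 2 * δ j) * n + 1) t * (t + k) := by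
    intro j _
    rw [recipBrickReg_eq _ _ _ (by exact_mod_cast ht)]
    push_cast; rfl
  rw [prod_congr rfl h, prod_mul_distrib, prod_const, card_univ, Fintype.card_fin]
  ring

/-! ### `D`-integrality of the divided derivatives at a pole (Zudilin's Lemmas 15–16) -/

/-- **Generic part of Lai's L1**: for a lower bound `dmin ≤ δ_j` (all `j`) with `2·dmin < M`, `2δ_j ≤ M`, and a pole
index `dmin·n ≤ k ≤ (M − dmin)·n`: `D_{(M−2·dmin)n}^j · (1/j!) · laiG^{(j)}(−k) ∈ ℤ` for all `j ≤ N`. [this file] -/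
theorem laiG_isDInt (J r M n : ℕ) (δ : Fin J → ℕ) (hδ : ∀ j, 2 * δ j ≤ M) (dmin : ℕ) (hmin : ∀ j, dmin ≤ δ j)
    (h2 : 2 * dmin < M) {k : ℕ} (hk₁ : dmin * n ≤ k) (hk₂ : k ≤ (M - dmin) * n) (N : ℕ) :
    IsDInt (Nat.lcmUpto ((M - 2 * dmin) * n)) N (laiG J r M n δ k) (-(k : ℚ)) := by
  set d := Nat.lcmUpto ((M - 2 * dmin) * n) with hd
  have hpt : ((-(k : ℤ) : ℤ) : ℚ) = -(k : ℚ) := by push_cast; ring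
  -- the linear factor
  have hlin : IsDInt d N (fun t : ℚ => 2 * t + (M : ℚ) * n) (-(k : ℚ)) := by
    have h := IsDInt.linear d N 2 (M * n) (-(k : ℤ))
    rw [hpt] at h
    exact h.congr (Eventually.of_forall fun t => by push_cast; ring)
  -- the polynomial bricks (length `n`)
  have hdvd : Nat.lcmUpto n ∣ d := lcmUpto_dvd_lcmUpto (by
    have : 1 ≤ M - 2 * dmin := by omega
    calc n = 1 * n := (one_mul n).symm
      _ ≤ (M - 2 * dmin) * n := Nat.mul_le_mul_right n this)
  have hP : ∀ q ∈ range r, IsDInt d N (polyBrick (-((r * n : ℕ) : ℤ) + ((q * n : ℕ) : ℤ)) n) (-(k : ℚ)) := by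
    intro q _
    have h := (polyBrick_isDInt (-((r * n : ℕ) : ℤ) + ((q * n : ℕ) : ℤ)) n (-(k : ℤ)) N).of_dvd hdvd
    rwa [hpt] at h
  have hP' : ∀ q ∈ range r, IsDInt d N (polyBrick (((M * n + 1 + q * n : ℕ) : ℤ)) n) (-(k : ℚ)) := by
    intro q _
    have h := (polyBrick_isDInt (((M * n + 1 + q * n : ℕ) : ℤ)) n (-(k : ℤ)) N).of_dvd hdvd
    rwa [hpt] at h
  -- the regularised reciprocal bricks: `a₀ = dmin n`, `b₀ = (M − dmin) n + 1`
  have hQ : ∀ j ∈ (univ : Finset (Fin J)),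
      IsDInt d N (recipBrickReg (((δ j * n : ℕ) : ℤ)) ((M - 2 * δ j) * n + 1) (k : ℤ)) (-(k : ℚ)) := by
    intro j _
    have hδj := hδ j
    have hmj := hmin j
    have hsum : δ j * n + ((M - 2 * δ j) * n + 1) = (M - δ j) * n + 1 := by
      have : δ j * n + (M - 2 * δ j) * n = (M - δ j) * n := by
        rw [← add_mul]; congr 1; omega
      omega
    have h := recipBrickReg_isDInt (a₀ := ((dmin * n : ℕ) : ℤ)) (b₀ := (((M - dmin) * n + 1 : ℕ) : ℤ))
      (a := ((δ j * n : ℕ) : ℤ)) (m := (M - 2 * δ j) * n + 1) (k := (k : ℤ)) (by omega)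
      (by exact_mod_cast Nat.mul_le_mul_right n hmj)
      (by
        rw [← Nat.cast_add, hsum]
        exact_mod_cast Nat.succ_le_succ (Nat.mul_le_mul_right n (by omega : M - δ j ≤ M - dmin)))
      (by exact_mod_cast hk₁) (by exact_mod_cast Nat.lt_succ_of_le hk₂) N
    have e : ((((M - dmin) * n + 1 : ℕ) : ℤ) - ((dmin * n : ℕ) : ℤ) - 1).toNat = (M - 2 * dmin) * n := by
      have h1 : (M - dmin) * n = (M - 2 * dmin) * n + dmin * n := by
        rw [← add_mul]; congr 1; omega
      push_cast [h1]
      omega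
    rw [e, ← hd] at h
    have hpt' : (-((k : ℤ) : ℚ)) = -(k : ℚ) := by push_cast; ring
    rwa [hpt'] at h
  have hall := ((hlin.mul (IsDInt.prod (range r) hP)).mul (IsDInt.prod (range r) hP')).mul
    (IsDInt.prod univ hQ)
  exact hall.congr (Eventually.of_forall fun t => by simp only [laiG])

/-! ### `p`-adic orders of the divided derivatives (Zudilin's Lemmas 17–18) -/

/-- The sum of the brick exponents of `laiG` at `−k` for the prime `p` (shapes exactly as produced by
`polyBrick_isDOrd` / `recipBrickReg_isDOrd`). [this file] -/
def laiBrickExp (J r M n : ℕ) (δ : Fin J → ℕ) (k p : ℕ) : ℤ :=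
  0 + (∑ q ∈ range r, ((-((r * n : ℕ) : ℤ) + ((q * n : ℕ) : ℤ) + n - 1 - (k : ℤ)) / p
        - (-((r * n : ℕ) : ℤ) + ((q * n : ℕ) : ℤ) - 1 - (k : ℤ)) / p - (n : ℤ) / p))
    + (∑ q ∈ range r, (((((M * n + 1 + q * n : ℕ) : ℤ)) + n - 1 - (k : ℤ)) / p
        - ((((M * n + 1 + q * n : ℕ) : ℤ)) - 1 - (k : ℤ)) / p - (n : ℤ) / p))
    + ∑ j : Fin J, (((((M - 2 * δ j) * n + 1 : ℕ) : ℤ) - 1) / p - ((k : ℤ) - ((δ j * n : ℕ) : ℤ)) / p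
        - ((((δ j * n : ℕ) : ℤ)) + ((((M - 2 * δ j) * n + 1 : ℕ) : ℤ)) - 1 - (k : ℤ)) / p)

/-- **`ord_p laiG^{(j)}(−k) ≥ −j + laiBrickExp`** for `j ≤ N`, primes `p` with `(M − 2·dmin)n < p²`, and pole indices
`dmin·n ≤ k ≤ (M−dmin)·n`. [this file] -/
theorem laiG_isDOrd (J r M n : ℕ) (δ : Fin J → ℕ) (hδ : ∀ j, 2 * δ j ≤ M) (dmin : ℕ) (hmin : ∀ j, dmin ≤ δ j)
    (h2 : 2 * dmin < M) {p : ℕ} [hp : Fact p.Prime] (hp2 : (M - 2 * dmin) * n < p ^ 2)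
    {k : ℕ} (hk₁ : dmin * n ≤ k) (hk₂ : k ≤ (M - dmin) * n) (N : ℕ) :
    IsDOrd p (laiBrickExp J r M n δ k p) N (laiG J r M n δ k) (-(k : ℚ)) := by
  have hpt' : (-((k : ℤ) : ℚ)) = -(k : ℚ) := by push_cast; ring
  -- linear factor: all derivatives are integers
  have hlin : IsDOrd p 0 N (fun t : ℚ => 2 * t + (M : ℚ) * n) (-(k : ℚ)) := by
    refine IsDOrd.of_int_derivs ((contDiffAt_const.mul contDiffAt_id).add contDiffAt_const) fun j _ => ?_
    rw [iteratedDeriv_affine 2 ((M : ℚ) * n) (-(k : ℚ)) j]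
    rcases j with _ | _ | j
    · exact ⟨M * n - 2 * k, by push_cast; simp; ring⟩
    · exact ⟨2, by simp⟩
    · exact ⟨0, by simp⟩
  -- polynomial bricks (Lemma 17), `n < p²`
  have hn : n < p ^ 2 := lt_of_le_of_lt (by
    have : 1 ≤ M - 2 * dmin := by omega
    calc n = 1 * n := (one_mul n).symm
      _ ≤ (M - 2 * dmin) * n := Nat.mul_le_mul_right n this) hp2
  have hP : ∀ q ∈ range r, IsDOrd p ((-((r * n : ℕ) : ℤ) + ((q * n : ℕ) : ℤ) + n - 1 - (k : ℤ)) / p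
      - (-((r * n : ℕ) : ℤ) + ((q * n : ℕ) : ℤ) - 1 - (k : ℤ)) / p - (n : ℤ) / p) N
      (polyBrick (-((r * n : ℕ) : ℤ) + ((q * n : ℕ) : ℤ)) n) (-(k : ℚ)) := by
    intro q _
    have h := polyBrick_isDOrd p (-((r * n : ℕ) : ℤ) + ((q * n : ℕ) : ℤ)) n hn (k : ℤ) N
    rwa [hpt'] at h
  have hP' : ∀ q ∈ range r, IsDOrd p (((((M * n + 1 + q * n : ℕ) : ℤ)) + n - 1 - (k : ℤ)) / p
      - ((((M * n + 1 + q * n : ℕ) : ℤ)) - 1 - (k : ℤ)) / p - (n : ℤ) / p) N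
      (polyBrick (((M * n + 1 + q * n : ℕ) : ℤ)) n) (-(k : ℚ)) := by
    intro q _
    have h := polyBrick_isDOrd p (((M * n + 1 + q * n : ℕ) : ℤ)) n hn (k : ℤ) N
    rwa [hpt'] at h
  -- reciprocal bricks (Lemma 18), `a₀ = dmin n`, `b₀ = (M − dmin) n + 1`
  have hQ : ∀ j ∈ (univ : Finset (Fin J)), IsDOrd p (((((M - 2 * δ j) * n + 1 : ℕ) : ℤ) - 1) / p
      - ((k : ℤ) - ((δ j * n : ℕ) : ℤ)) / p
      - ((((δ j * n : ℕ) : ℤ)) + ((((M - 2 * δ j) * n + 1 : ℕ) : ℤ)) - 1 - (k : ℤ)) / p) N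
      (recipBrickReg (((δ j * n : ℕ) : ℤ)) ((M - 2 * δ j) * n + 1) (k : ℤ)) (-(k : ℚ)) := by
    intro j _
    have hδj := hδ j
    have hmj := hmin j
    have hsum : δ j * n + ((M - 2 * δ j) * n + 1) = (M - δ j) * n + 1 := by
      have : δ j * n + (M - 2 * δ j) * n = (M - δ j) * n := by
        rw [← add_mul]; congr 1; omega
      omega
    have hb0 : ((((M - dmin) * n + 1 : ℕ) : ℤ)) - ((dmin * n : ℕ) : ℤ) - 1 < (p : ℤ) ^ 2 := by
      have h1 : (M - dmin) * n = (M - 2 * dmin) * n + dmin * n := by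
        rw [← add_mul]; congr 1; omega
      push_cast [h1]
      have : (((M - 2 * dmin) * n : ℕ) : ℤ) < (p : ℤ) ^ 2 := by exact_mod_cast hp2
      push_cast at this
      linarith
    have h := recipBrickReg_isDOrd p (a₀ := ((dmin * n : ℕ) : ℤ)) (b₀ := (((M - dmin) * n + 1 : ℕ) : ℤ))
      (a := ((δ j * n : ℕ) : ℤ)) (m := (M - 2 * δ j) * n + 1) (k := (k : ℤ)) (by omega)
      (by exact_mod_cast Nat.mul_le_mul_right n hmj)
      (by
        rw [← Nat.cast_add, hsum]
        exact_mod_cast Nat.succ_le_succ (Nat.mul_le_mul_right n (by omega : M - δ j ≤ M - dmin)))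
      (by exact_mod_cast hk₁) (by exact_mod_cast Nat.lt_succ_of_le hk₂) hb0 N
    rwa [hpt'] at h
  have hall := ((hlin.mul (IsDOrd.prod (range r) hP)).mul (IsDOrd.prod (range r) hP')).mul
    (IsDOrd.prod univ hQ)
  exact hall.congr (Eventually.of_forall fun t => by simp only [laiG])

/-! ### The exponents are Lai's `φ̃(n/p, k/p)` -/

/-- Lai's two-variable saving function at `x = n/p`, `y = k/p` in integer-division form:
`⌊(k+rn)/p⌋ + ⌊((r+M)n−k)/p⌋ − ⌊k/p⌋ − ⌊(Mn−k)/p⌋ − 2r⌊n/p⌋ + Σ_j (⌊(M−2δ_j)n/p⌋ − ⌊(k−δ_jn)/p⌋ − ⌊((M−δ_j)n−k)/p⌋)`.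
[cite: Lai2024BallRivoal, §13 (the function φ̃)] -/
def laiPhiDiv (J r M n : ℕ) (δ : Fin J → ℕ) (k p : ℕ) : ℤ :=
  ((k : ℤ) + r * n) / p + (((r : ℤ) + M) * n - k) / p - (k : ℤ) / p - ((M : ℤ) * n - k) / p - 2 * r * ((n : ℤ) / p)
    + ∑ j : Fin J, ((((M - 2 * δ j) * n : ℕ) : ℤ) / p - ((k : ℤ) - ((δ j * n : ℕ) : ℤ)) / p
        - ((((M - δ j) * n : ℕ) : ℤ) - k) / p)

/-- **The brick exponents telescope to `φ̃(n/p, k/p)`** (`2δ_j ≤ M`). [this file] -/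
theorem laiBrickExp_eq_laiPhiDiv (J r M n : ℕ) (δ : Fin J → ℕ) (hδ : ∀ j, 2 * δ j ≤ M) (k p : ℕ) :
    laiBrickExp J r M n δ k p = laiPhiDiv J r M n δ k p := by
  unfold laiBrickExp laiPhiDiv
  -- the two telescoping sums
  have h1 : ∑ q ∈ range r, ((-((r * n : ℕ) : ℤ) + ((q * n : ℕ) : ℤ) + n - 1 - (k : ℤ)) / p
        - (-((r * n : ℕ) : ℤ) + ((q * n : ℕ) : ℤ) - 1 - (k : ℤ)) / p - (n : ℤ) / p)
      = ((-1 - (k : ℤ)) / p - (-((r * n : ℕ) : ℤ) - 1 - (k : ℤ)) / p) - r * ((n : ℤ) / p) := by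
    rw [sum_sub_distrib, sum_const, card_range, nsmul_eq_mul]
    have := sum_range_sub (fun q : ℕ => (-((r * n : ℕ) : ℤ) + ((q * n : ℕ) : ℤ) - 1 - (k : ℤ)) / p) r
    have e : ∀ q : ℕ, (-((r * n : ℕ) : ℤ) + (((q + 1) * n : ℕ) : ℤ) - 1 - (k : ℤ))
        = (-((r * n : ℕ) : ℤ) + ((q * n : ℕ) : ℤ) + n - 1 - (k : ℤ)) := fun q => by push_cast; ring
    simp_rw [e] at this
    rw [this]
    push_cast; ring_nf
  have h2 : ∑ q ∈ range r, (((((M * n + 1 + q * n : ℕ) : ℤ)) + n - 1 - (k : ℤ)) / p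
        - ((((M * n + 1 + q * n : ℕ) : ℤ)) - 1 - (k : ℤ)) / p - (n : ℤ) / p)
      = ((((M : ℤ) * n + r * n - k) / p - ((M : ℤ) * n - k) / p)) - r * ((n : ℤ) / p) := by
    rw [sum_sub_distrib, sum_const, card_range, nsmul_eq_mul]
    have := sum_range_sub (fun q : ℕ => ((((M * n + 1 + q * n : ℕ) : ℤ)) - 1 - (k : ℤ)) / p) r
    have e : ∀ q : ℕ, ((((M * n + 1 + (q + 1) * n : ℕ) : ℤ)) - 1 - (k : ℤ))
        = ((((M * n + 1 + q * n : ℕ) : ℤ)) + n - 1 - (k : ℤ)) := fun q => by push_cast; ring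
    simp_rw [e] at this
    rw [this]
    push_cast; ring_nf
  rw [h1, h2]
  -- the numerator floors: (7.5) `⌊(−z−1)/p⌋ = −⌊z/p⌋ − 1`
  rcases Nat.eq_zero_or_pos p with rfl | hp
  · simp
  have hp0 : (0 : ℤ) < p := by exact_mod_cast hp
  have e1 : (-1 - (k : ℤ)) / p = -((k : ℤ) / p) - 1 := by
    rw [show (-1 - (k : ℤ)) = -(k : ℤ) - 1 by ring]; exact Int.neg_sub_one_ediv_eq _ hp0
  have e2 : (-((r * n : ℕ) : ℤ) - 1 - (k : ℤ)) / p = -(((k : ℤ) + r * n) / p) - 1 := by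
    rw [show (-((r * n : ℕ) : ℤ) - 1 - (k : ℤ)) = -((k : ℤ) + r * n) - 1 by push_cast; ring]
    exact Int.neg_sub_one_ediv_eq _ hp0
  rw [e1, e2]
  -- the block sums agree term by term
  have e3 : ∀ j : Fin J, (((((M - 2 * δ j) * n + 1 : ℕ) : ℤ) - 1) / p - ((k : ℤ) - ((δ j * n : ℕ) : ℤ)) / p
        - ((((δ j * n : ℕ) : ℤ)) + ((((M - 2 * δ j) * n + 1 : ℕ) : ℤ)) - 1 - (k : ℤ)) / p)
      = ((((M - 2 * δ j) * n : ℕ) : ℤ) / p - ((k : ℤ) - ((δ j * n : ℕ) : ℤ)) / p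
        - ((((M - δ j) * n : ℕ) : ℤ) - k) / p) := by
    intro j
    have hδj := hδ j
    have hsum : δ j * n + (M - 2 * δ j) * n = (M - δ j) * n := by
      rw [← add_mul]; congr 1; omega
    have c1 : ((((M - 2 * δ j) * n + 1 : ℕ) : ℤ) - 1) = (((M - 2 * δ j) * n : ℕ) : ℤ) := by push_cast; ring
    have c2 : ((((δ j * n : ℕ) : ℤ)) + ((((M - 2 * δ j) * n + 1 : ℕ) : ℤ)) - 1 - (k : ℤ))
        = ((((M - δ j) * n : ℕ) : ℤ) - k) := by
      rw [← hsum]; push_cast; ring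
    rw [c1, c2]
  rw [Finset.sum_congr rfl fun j _ => e3 j]
  have e4 : (((r : ℤ) + M) * n - k) = ((M : ℤ) * n + r * n - k) := by ring
  rw [e4]
  ring

end Summit.KontsevichZagierPeriods.Zeta5Search

end
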